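import Summits.AtomisticToContinuum.Crystallization.Theorems.ExcessDecayLiouvilleHcpLiouvilleBlowdownLinRows
import Summits.AtomisticToContinuum.Crystallization.Theorems.ExcessDecayLiouvilleHcpLiouvilleBlowdownRemainderSum
import Summits.AtomisticToContinuum.Crystallization.Theorems.ExcessDecayLiouvilleVerticalDifferences
import Summits.AtomisticToContinuum.Crystallization.Theorems.ExcessDecayLiouvilleTranslation

/-!
# `ExcessDecayLiouville.HcpLiouville` (stmt-AtomisticToContinuum-9332), line `Sketch` (skeleton v4): lattice differences versus the nearest-neighbour energy

Helper for stub `stub_interior` (steps (4)–(5) of the interior estimate for `L`-harmonic fields): book-keeping of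
lattice differences of a field `F` on the sites `S = Sites₀ t A` of an admissible hcp-like datum against the
nearest-neighbour energy `Blowdown.nnEnergy S F c r` of the blow-down vocabulary:

* `Blowdown.sum_ball_single_le_nnEnergy` — a sum of ONE nearest-neighbour bond per site of `B_r(c)` is `≤ nnEnergy`;
* `Blowdown.tsum_ball_genDiff_sq_le` — for the generators `e ∈ {u₁, u₂, w₃}` of `Λ₀`,
  `Σ_{p ∈ S∩B_ρ} ‖F(p + Ae) − F p‖² ≤ 4·nnEnergy S F c (ρ + 2)` (`u₁, u₂` are nearest-neighbour bonds; the vertical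
  period is two nearest-neighbour cross bonds, `exists_verticalStep`);
* `Blowdown.tsum_ball_crossDiff_sq_le` — the cross difference `𝟙_{S₀}(p)(F(p + (t 1 − t 0)) − F p)` likewise (factor `1`);
* `Blowdown.oscAt_diff_le` — the `ℓ²`-mass of a difference of a field supported in `B_{R₀}` is `≤ 4×` the mass
  (registered carrier `blowdown_differences`), and its support lies in `B_{R₀+2}`.

All `[folklore]`; a `--supports` helper for item stmt-AtomisticToContinuum-9332, nothing here closes an item.
-/

noncomputable section

namespace Summit.AtomisticToContinuum.Crystallization.Theorems.ExcessDecayLiouville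

open scoped BigOperators Topology Classical InnerProductSpace RealInnerProductSpace
open Literature.MathematicalPhysics.StatisticalMechanics
open Summit.AtomisticToContinuum.Crystallization.Theses.ExcessDecayLiouville
open Summit.AtomisticToContinuum.Crystallization.Theorems.PhononStabilityNegative

namespace Blowdown

open LevelOne

variable {t : Fin 2 → (EuclideanSpace ℝ (Fin 3))}
  {A : (EuclideanSpace ℝ (Fin 3)) →L[ℝ] (EuclideanSpace ℝ (Fin 3))}

/-! ## The generators -/

/-- The three generators `u₁, u₂, w₃` lie in `Λ₀` and have `‖A e‖ ≤ 2` for an admissible cell. [folklore] -/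
theorem gen_mem_and_norm_le (hA : Adm₀ A) {e : EuclideanSpace ℝ (Fin 3)}
    (he : e ∈ ({triangularVec₁ 1, triangularVec₂ 1, layerNormal (2 * Real.sqrt (2 / 3))} :
      Finset (EuclideanSpace ℝ (Fin 3)))) : e ∈ Λ₀ ∧ ‖A e‖ ≤ 2 := by
  have hn : ‖e‖ ≤ 2 := by
    simp only [Finset.mem_insert, Finset.mem_singleton] at he
    rcases he with rfl | rfl | rfl
    · rw [norm_triangularVec₁]; norm_num
    · have h := hcpLiouvilleLam_norm_sq 0 1 0
      simp only [Int.cast_zero, zero_smul, Int.cast_one, one_smul, zero_add, add_zero] at h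
      nlinarith [norm_nonneg (triangularVec₂ 1 : EuclideanSpace ℝ (Fin 3))]
    · have h := hcpLiouvilleLam_norm_sq 0 0 1
      simp only [Int.cast_zero, zero_smul, Int.cast_one, one_smul, zero_add] at h
      nlinarith [norm_nonneg (layerNormal (2 * Real.sqrt (2 / 3)) : EuclideanSpace ℝ (Fin 3))]
  have hm : e ∈ Λ₀ := by
    simp only [Finset.mem_insert, Finset.mem_singleton] at he
    rcases he with rfl | rfl | rfl
    · exact triangularVec₁_mem_Λ₀
    · exact ⟨0, 1, 0, by simp⟩
    · exact layerNormal_two_mem_Λ₀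
  refine ⟨hm, (norm_apply_le_of_adm₀ hA e).trans ?_⟩
  linarith

/-! ## One bond per site against the nearest-neighbour energy -/

/-- **One nearest-neighbour bond per site**: for any choice `q p ∈ S` with `dist p (q p) ≤ 11/10`,
`Σ_{p ∈ S∩B_r} ‖F p − F (q p)‖² ≤ nnEnergy S F c r`. [folklore] -/
theorem sum_ball_single_le_nnEnergy (hA : Adm₀ A) (hI : Inner₀ t A)
    (F : EuclideanSpace ℝ (Fin 3) → EuclideanSpace ℝ (Fin 3)) (c : EuclideanSpace ℝ (Fin 3)) (r : ℝ)
    (q : Sites₀ t A → Sites₀ t A)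
    (hq : ∀ p : Sites₀ t A, dist (p : EuclideanSpace ℝ (Fin 3)) ((q p : Sites₀ t A) : EuclideanSpace ℝ (Fin 3)) ≤ 11 / 10) :
    ∑ p ∈ (finite_sites_ball hA hI c r).toFinset, ‖F p - F (q p)‖ ^ 2 ≤ nnEnergy (Sites₀ t A) F c r := by
  rw [nnEnergy, tsum_ball_eq_sum hA hI c r (fun x => ∑' q' : Sites₀ t A,
    if dist x q' ≤ 11 / 10 then ‖F x - F q'‖ ^ 2 else 0)]
  refine Finset.sum_le_sum fun p _ => ?_
  have hs : Summable fun q' : Sites₀ t A =>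
      if dist (p : EuclideanSpace ℝ (Fin 3)) q' ≤ 11 / 10 then ‖F p - F q'‖ ^ 2 else 0 := by
    refine summable_of_ne_finset_zero (s := (finite_sites_ball hA hI (p : EuclideanSpace ℝ (Fin 3)) (11 / 10)).toFinset)
      fun q' hq' => if_neg fun h => hq' ?_
    rw [Set.Finite.mem_toFinset]
    show dist (q' : EuclideanSpace ℝ (Fin 3)) p ≤ 11 / 10
    rwa [dist_comm]
  have h := hs.le_tsum (q p) (fun q' _ => by split_ifs <;> positivity)
  rwa [if_pos (hq p)] at h

/-! ## Generator differences -/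

/-- **Generator differences against the energy**: for `e ∈ {u₁, u₂, w₃}`,
`Σ'_{p ∈ S∩B_ρ} ‖F(p + Ae) − F p‖² ≤ 4·nnEnergy S F c (ρ + 2)`. [folklore] -/
theorem tsum_ball_genDiff_sq_le (hA : Adm₀ A) (hI : Inner₀ t A)
    (F : EuclideanSpace ℝ (Fin 3) → EuclideanSpace ℝ (Fin 3)) (c : EuclideanSpace ℝ (Fin 3)) (ρ : ℝ)
    {e : EuclideanSpace ℝ (Fin 3)}
    (he : e ∈ ({triangularVec₁ 1, triangularVec₂ 1, layerNormal (2 * Real.sqrt (2 / 3))} :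
      Finset (EuclideanSpace ℝ (Fin 3)))) :
    ∑' p : {s : EuclideanSpace ℝ (Fin 3) // s ∈ Sites₀ t A ∧ dist s c ≤ ρ}, ‖F ((p : EuclideanSpace ℝ (Fin 3)) + A e) - F p‖ ^ 2 ≤
      4 * nnEnergy (Sites₀ t A) F c (ρ + 2) := by
  rw [tsum_ball_eq_sum hA hI c ρ (fun x => ‖F (x + A e) - F x‖ ^ 2)]
  have hE0 : 0 ≤ nnEnergy (Sites₀ t A) F c (ρ + 2) := nnEnergy_nonneg _ _ _ _
  have hmono := nnEnergy_le_of_le hA hI F c (show ρ ≤ ρ + 2 by linarith)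
  obtain ⟨hmem, -⟩ := gen_mem_and_norm_le hA he
  -- case of a nearest-neighbour generator
  by_cases hshort : ‖A e‖ ≤ 11 / 10
  · set q : Sites₀ t A → Sites₀ t A := fun p => ⟨(p : EuclideanSpace ℝ (Fin 3)) + A e, add_mem_sites₀ p.2 hmem⟩
    have hq : ∀ p : Sites₀ t A, dist (p : EuclideanSpace ℝ (Fin 3)) ((q p : Sites₀ t A) : EuclideanSpace ℝ (Fin 3)) ≤
        11 / 10 := fun p => by
      show dist (p : EuclideanSpace ℝ (Fin 3)) ((p : EuclideanSpace ℝ (Fin 3)) + A e) ≤ 11 / 10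
      rwa [dist_eq_norm, sub_add_cancel_left, norm_neg]
    have h1 := sum_ball_single_le_nnEnergy hA hI F c ρ q hq
    calc ∑ p ∈ (finite_sites_ball hA hI c ρ).toFinset, ‖F ((p : EuclideanSpace ℝ (Fin 3)) + A e) - F p‖ ^ 2
        = ∑ p ∈ (finite_sites_ball hA hI c ρ).toFinset, ‖F p - F (q p)‖ ^ 2 :=
          Finset.sum_congr rfl fun p _ => by rw [norm_sub_rev]
      _ ≤ nnEnergy (Sites₀ t A) F c ρ := h1
      _ ≤ 4 * nnEnergy (Sites₀ t A) F c (ρ + 2) := by linarith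
  -- the vertical period: two cross bonds
  · have hew : e = layerNormal (2 * Real.sqrt (2 / 3)) := by
      simp only [Finset.mem_insert, Finset.mem_singleton] at he
      rcases he with rfl | rfl | rfl
      · exfalso; apply hshort
        calc ‖A (triangularVec₁ 1)‖ ≤ 199 / 200 * ‖(triangularVec₁ 1 : EuclideanSpace ℝ (Fin 3))‖ :=
            norm_apply_le_of_adm₀ hA _
          _ ≤ 11 / 10 := by rw [norm_triangularVec₁]; norm_num
      · exfalso; apply hshort
        have h := hcpLiouvilleLam_norm_sq 0 1 0
        simp only [Int.cast_zero, zero_smul, Int.cast_one, one_smul, zero_add, add_zero] at h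
        have hn : ‖(triangularVec₂ 1 : EuclideanSpace ℝ (Fin 3))‖ = 1 := by
          nlinarith [norm_nonneg (triangularVec₂ 1 : EuclideanSpace ℝ (Fin 3))]
        calc ‖A (triangularVec₂ 1)‖ ≤ 199 / 200 * ‖(triangularVec₂ 1 : EuclideanSpace ℝ (Fin 3))‖ :=
            norm_apply_le_of_adm₀ hA _
          _ ≤ 11 / 10 := by rw [hn]; norm_num
      · rfl
    subst hew
    obtain ⟨σ, hσi, hσd, hσσ⟩ := exists_verticalStep hA hI
    set P := (finite_sites_ball hA hI c ρ).toFinset with hP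
    set P' := (finite_sites_ball hA hI c (ρ + 2)).toFinset with hP'
    have hterm : ∀ p : Sites₀ t A, ‖F ((p : EuclideanSpace ℝ (Fin 3)) + A (layerNormal (2 * Real.sqrt (2 / 3)))) - F p‖ ^ 2 ≤
        2 * ‖F p - F (σ p)‖ ^ 2 + 2 * ‖F (σ p) - F (σ (σ p))‖ ^ 2 := by
      intro p
      rw [← hσσ p, norm_sub_rev]
      have h := norm_add_le (F p - F (σ p)) (F (σ p) - F (σ (σ p)))
      rw [sub_add_sub_cancel] at h
      have hc := norm_nonneg (F p - F (σ (σ p)))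
      have h' := pow_le_pow_left₀ hc h 2
      nlinarith [h', sq_nonneg (‖F p - F (σ p)‖ - ‖F (σ p) - F (σ (σ p))‖)]
    have h1 : ∑ p ∈ P, ‖F p - F (σ p)‖ ^ 2 ≤ nnEnergy (Sites₀ t A) F c ρ :=
      sum_ball_single_le_nnEnergy hA hI F c ρ σ hσd
    have h2 : ∑ p ∈ P, ‖F (σ p) - F (σ (σ p))‖ ^ 2 ≤ nnEnergy (Sites₀ t A) F c (ρ + 2) := by
      rw [← Finset.sum_image (s := P) (g := σ) (f := fun x : Sites₀ t A => ‖F x - F (σ x)‖ ^ 2)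
        (fun x _ y _ h => hσi h)]
      refine (Finset.sum_le_sum_of_subset_of_nonneg (fun x hx => ?_) fun _ _ _ => sq_nonneg _).trans
        (sum_ball_single_le_nnEnergy hA hI F c (ρ + 2) σ hσd)
      simp only [Finset.mem_image] at hx
      obtain ⟨p, hp, rfl⟩ := hx
      rw [hP, Set.Finite.mem_toFinset] at hp
      rw [Set.Finite.mem_toFinset]
      have h3 := dist_triangle ((σ p : Sites₀ t A) : EuclideanSpace ℝ (Fin 3)) p c
      have h4 := hσd p
      rw [dist_comm] at h4
      show dist ((σ p : Sites₀ t A) : EuclideanSpace ℝ (Fin 3)) c ≤ ρ + 2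
      have : dist (p : EuclideanSpace ℝ (Fin 3)) c ≤ ρ := hp
      linarith
    calc ∑ p ∈ P, ‖F ((p : EuclideanSpace ℝ (Fin 3)) + A (layerNormal (2 * Real.sqrt (2 / 3)))) - F p‖ ^ 2
        ≤ ∑ p ∈ P, (2 * ‖F p - F (σ p)‖ ^ 2 + 2 * ‖F (σ p) - F (σ (σ p))‖ ^ 2) := Finset.sum_le_sum fun p _ => hterm p
      _ = 2 * ∑ p ∈ P, ‖F p - F (σ p)‖ ^ 2 + 2 * ∑ p ∈ P, ‖F (σ p) - F (σ (σ p))‖ ^ 2 := by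
          rw [Finset.sum_add_distrib, Finset.mul_sum, Finset.mul_sum]
      _ ≤ 2 * nnEnergy (Sites₀ t A) F c ρ + 2 * nnEnergy (Sites₀ t A) F c (ρ + 2) := by linarith
      _ ≤ 4 * nnEnergy (Sites₀ t A) F c (ρ + 2) := by linarith

/-! ## The cross difference -/

/-- **The cross difference against the energy**: with `τ = t 1 − t 0` (a nearest-neighbour bond of length `≤ 11/10`,
`norm_t_sub_t_le`) and `S₀` the sublattice `0`,
`Σ'_{p ∈ S∩B_ρ} ‖𝟙_{S₀}(p)·(F(p + τ) − F p)‖² ≤ nnEnergy S F c ρ`. [folklore] -/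
theorem tsum_ball_crossDiff_sq_le (hA : Adm₀ A) (hI : Inner₀ t A)
    (F : EuclideanSpace ℝ (Fin 3) → EuclideanSpace ℝ (Fin 3)) (c : EuclideanSpace ℝ (Fin 3)) (ρ : ℝ) :
    ∑' p : {s : EuclideanSpace ℝ (Fin 3) // s ∈ Sites₀ t A ∧ dist s c ≤ ρ},
      ‖(if ∃ z ∈ Λ₀, (p : EuclideanSpace ℝ (Fin 3)) = t 0 + A z then
        F ((p : EuclideanSpace ℝ (Fin 3)) + (t 1 - t 0)) - F p else 0)‖ ^ 2 ≤
      nnEnergy (Sites₀ t A) F c ρ := by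
  rw [tsum_ball_eq_sum hA hI c ρ (fun x => ‖(if ∃ z ∈ Λ₀, x = t 0 + A z then F (x + (t 1 - t 0)) - F x else 0)‖ ^ 2)]
  have hmem0 : ∀ p : Sites₀ t A, (∃ z ∈ Λ₀, (p : EuclideanSpace ℝ (Fin 3)) = t 0 + A z) →
      (p : EuclideanSpace ℝ (Fin 3)) + (t 1 - t 0) ∈ Sites₀ t A := by
    rintro p ⟨z, hz, hp⟩
    exact ⟨1, z, hz, by rw [hp]; abel⟩
  set q : Sites₀ t A → Sites₀ t A := fun p =>
    if h : ∃ z ∈ Λ₀, (p : EuclideanSpace ℝ (Fin 3)) = t 0 + A z then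
      ⟨(p : EuclideanSpace ℝ (Fin 3)) + (t 1 - t 0), hmem0 p h⟩ else p with hq_def
  have hq : ∀ p : Sites₀ t A, dist (p : EuclideanSpace ℝ (Fin 3)) ((q p : Sites₀ t A) : EuclideanSpace ℝ (Fin 3)) ≤
      11 / 10 := by
    intro p
    by_cases h : ∃ z ∈ Λ₀, (p : EuclideanSpace ℝ (Fin 3)) = t 0 + A z
    · have : ((q p : Sites₀ t A) : EuclideanSpace ℝ (Fin 3)) = p + (t 1 - t 0) := by
        simp only [hq_def, dif_pos h]
      rw [this, dist_eq_norm, sub_add_cancel_left, norm_neg]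
      exact norm_t_sub_t_le hA hI
    · have : q p = p := by simp only [hq_def, dif_neg h]
      rw [this, dist_self]; norm_num
  refine (Finset.sum_le_sum fun p _ => ?_).trans (sum_ball_single_le_nnEnergy hA hI F c ρ q hq)
  by_cases h : ∃ z ∈ Λ₀, (p : EuclideanSpace ℝ (Fin 3)) = t 0 + A z
  · have : ((q p : Sites₀ t A) : EuclideanSpace ℝ (Fin 3)) = p + (t 1 - t 0) := by
      simp only [hq_def, dif_pos h]
    rw [if_pos h, this, norm_sub_rev]
  · rw [if_neg h, norm_zero, zero_pow two_ne_zero]; exact sq_nonneg _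

/-! ## The `ℓ²`-mass of a difference -/

/-- **Mass and support of a lattice difference**: if `F` vanishes on the sites outside `B_{R₀}(c)`, `e ∈ Λ₀`,
`‖A e‖ ≤ 2`, then `oscAt S (F(· + Ae) − F) c (R₀ + 2) 0 ≤ 4·oscAt S F c R₀ 0` and the difference vanishes on the sites
outside `B_{R₀+2}(c)`. [folklore] -/
theorem oscAt_diff_le (hA : Adm₀ A) (hI : Inner₀ t A) {F : EuclideanSpace ℝ (Fin 3) → EuclideanSpace ℝ (Fin 3)}
    {c : EuclideanSpace ℝ (Fin 3)} {R₀ : ℝ} {e : EuclideanSpace ℝ (Fin 3)} (he : e ∈ Λ₀) (hAe : ‖A e‖ ≤ 2)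
    (hsupp : ∀ q : Sites₀ t A, R₀ < dist (q : EuclideanSpace ℝ (Fin 3)) c → F q = 0) :
    oscAt (Sites₀ t A) (fun x => F (x + A e) - F x) c (R₀ + 2) 0 ≤ 4 * oscAt (Sites₀ t A) F c R₀ 0 ∧
      ∀ q : Sites₀ t A, R₀ + 2 < dist (q : EuclideanSpace ℝ (Fin 3)) c →
        F ((q : EuclideanSpace ℝ (Fin 3)) + A e) - F q = 0 := by
  have hshift : ∀ q : Sites₀ t A, R₀ + 2 < dist (q : EuclideanSpace ℝ (Fin 3)) c →
      F ((q : EuclideanSpace ℝ (Fin 3)) + A e) = 0 := by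
    intro q hq
    have h1 : dist ((q : EuclideanSpace ℝ (Fin 3)) + A e) q = ‖A e‖ := by rw [dist_eq_norm, add_sub_cancel_left]
    have h2 := dist_triangle (q : EuclideanSpace ℝ (Fin 3)) ((q : EuclideanSpace ℝ (Fin 3)) + A e) c
    rw [dist_comm (q : EuclideanSpace ℝ (Fin 3)) ((q : EuclideanSpace ℝ (Fin 3)) + A e)] at h2
    exact hsupp ⟨(q : EuclideanSpace ℝ (Fin 3)) + A e, add_mem_sites₀ q.2 he⟩ (by
      show R₀ < dist ((q : EuclideanSpace ℝ (Fin 3)) + A e) c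
      linarith)
  refine ⟨?_, fun q hq => by rw [hshift q hq, hsupp q (by linarith), sub_zero]⟩
  -- masses as sums over all sites
  set P := (finite_sites_ball hA hI c R₀).toFinset with hP
  set P' := (finite_sites_ball hA hI c (R₀ + 2)).toFinset with hP'
  have hmemP : ∀ q : Sites₀ t A, q ∈ P ↔ dist (q : EuclideanSpace ℝ (Fin 3)) c ≤ R₀ := fun q => by
    rw [hP, Set.Finite.mem_toFinset]; rfl
  have hmemP' : ∀ q : Sites₀ t A, q ∈ P' ↔ dist (q : EuclideanSpace ℝ (Fin 3)) c ≤ R₀ + 2 := fun q => by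
    rw [hP', Set.Finite.mem_toFinset]; rfl
  have hsF : Summable fun q : Sites₀ t A => ‖F q‖ ^ 2 := by
    refine summable_of_ne_finset_zero (s := P) fun q hq => ?_
    rw [hsupp q (not_le.1 fun h => hq ((hmemP q).2 h)), norm_zero]; norm_num
  have htF : ∑' q : Sites₀ t A, ‖F q‖ ^ 2 = oscAt (Sites₀ t A) F c R₀ 0 := by
    rw [oscAt, tsum_ball_eq_sum hA hI c R₀ (fun x => ‖F x - 0‖ ^ 2), tsum_eq_sum (s := P) (fun q hq => by
      rw [hsupp q (not_le.1 fun h => hq ((hmemP q).2 h)), norm_zero]; norm_num)]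
    simp only [sub_zero]
    rfl
  obtain ⟨σ, hσ⟩ := exists_sitesShift (t := t) (A := A) he
  have hsF' : Summable fun q : Sites₀ t A => ‖F ((q : EuclideanSpace ℝ (Fin 3)) + A e)‖ ^ 2 := by
    have : (fun q : Sites₀ t A => ‖F ((q : EuclideanSpace ℝ (Fin 3)) + A e)‖ ^ 2) =
        (fun q : Sites₀ t A => ‖F q‖ ^ 2) ∘ σ := by
      funext q; simp only [Function.comp_apply, hσ q]
    rw [this]; exact (σ.summable_iff).2 hsF
  have htF' : ∑' q : Sites₀ t A, ‖F ((q : EuclideanSpace ℝ (Fin 3)) + A e)‖ ^ 2 = ∑' q : Sites₀ t A, ‖F q‖ ^ 2 := by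
    have : (fun q : Sites₀ t A => ‖F ((q : EuclideanSpace ℝ (Fin 3)) + A e)‖ ^ 2) =
        (fun q : Sites₀ t A => ‖F q‖ ^ 2) ∘ σ := by
      funext q; simp only [Function.comp_apply, hσ q]
    rw [this]; exact σ.tsum_eq (fun q : Sites₀ t A => ‖F q‖ ^ 2)
  have hterm : ∀ q : Sites₀ t A, ‖F ((q : EuclideanSpace ℝ (Fin 3)) + A e) - F q‖ ^ 2 ≤
      2 * ‖F ((q : EuclideanSpace ℝ (Fin 3)) + A e)‖ ^ 2 + 2 * ‖F q‖ ^ 2 := by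
    intro q
    have h := norm_sub_le (F ((q : EuclideanSpace ℝ (Fin 3)) + A e)) (F q)
    have hc := norm_nonneg (F ((q : EuclideanSpace ℝ (Fin 3)) + A e) - F q)
    have h' := pow_le_pow_left₀ hc h 2
    nlinarith [h', sq_nonneg (‖F ((q : EuclideanSpace ℝ (Fin 3)) + A e)‖ - ‖F q‖)]
  calc oscAt (Sites₀ t A) (fun x => F (x + A e) - F x) c (R₀ + 2) 0
      = ∑ q ∈ P', ‖F ((q : EuclideanSpace ℝ (Fin 3)) + A e) - F q‖ ^ 2 := by
        rw [oscAt, tsum_ball_eq_sum hA hI c (R₀ + 2) (fun x => ‖F (x + A e) - F x - 0‖ ^ 2)]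
        simp only [sub_zero]
        rfl
    _ ≤ ∑ q ∈ P', (2 * ‖F ((q : EuclideanSpace ℝ (Fin 3)) + A e)‖ ^ 2 + 2 * ‖F q‖ ^ 2) :=
        Finset.sum_le_sum fun q _ => hterm q
    _ ≤ ∑' q : Sites₀ t A, (2 * ‖F ((q : EuclideanSpace ℝ (Fin 3)) + A e)‖ ^ 2 + 2 * ‖F q‖ ^ 2) :=
        ((hsF'.mul_left 2).add (hsF.mul_left 2)).sum_le_tsum P' fun q _ => by positivity
    _ = 4 * oscAt (Sites₀ t A) F c R₀ 0 := by
        rw [(hsF'.mul_left 2).tsum_add (hsF.mul_left 2), tsum_mul_left, tsum_mul_left, htF', htF]; ring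

end Blowdown

/-- Registered carrier of this helper file (crux stmt-AtomisticToContinuum-9332, line `Sketch` v4, stub
`stub_interior`, steps (4)–(5)): the `ℓ²`-mass of a lattice difference of a field vanishing on the sites outside
`B_{R₀}(c)` is at most four times the mass (`e ∈ Λ₀`, `‖A e‖ ≤ 2`). [folklore] -/
theorem blowdown_differences : ∀ (t : Fin 2 → (EuclideanSpace ℝ (Fin 3)))
    (A : (EuclideanSpace ℝ (Fin 3)) →L[ℝ] (EuclideanSpace ℝ (Fin 3))), Adm₀ A → Inner₀ t A →
    ∀ (F : (EuclideanSpace ℝ (Fin 3)) → (EuclideanSpace ℝ (Fin 3))) (c e : (EuclideanSpace ℝ (Fin 3))) (R₀ : ℝ),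
      e ∈ Λ₀ → ‖A e‖ ≤ 2 → (∀ q : Sites₀ t A, R₀ < dist (q : (EuclideanSpace ℝ (Fin 3))) c → F q = 0) →
      Blowdown.oscAt (Sites₀ t A) (fun x => F (x + A e) - F x) c (R₀ + 2) 0 ≤
        4 * Blowdown.oscAt (Sites₀ t A) F c R₀ 0 :=
  fun _ _ hA hI _ _ _ _ he hAe hsupp => (Blowdown.oscAt_diff_le hA hI he hAe hsupp).1

end Summit.AtomisticToContinuum.Crystallization.Theorems.ExcessDecayLiouville

end
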